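/-
Copyright (c) 2026 the pub-hodgecm-mathlib formalisation cell (harness21).  Prover seat hodgecm-mathlib-R90-C131-p02 (g0) (R90-TF S4 hand lent to L1
by CHAIR VALVE WORD W4), Track B «K2-LIT», hLiu418 = `stmt-HodgeConjecture-24832`; K1-a♮ line lead K2E5-p16 (g8) WORD #9 (1) «(Φ-S1) ROAD B, file (iii-b-1/2)».
THEOREMS ONLY (no `def`, no instance, no notation, no named-fact hypothesis, no `sorry`); lane `--supports stmt-HodgeConjecture-24832 --as helper`.
The two proofs are the TWISTED twins of ★ (H2-an) FILE 1 `K2LiuArchIntertwiningDominatedSwap` (K2Liu-p11) and ★ `K2LiuArchIntertwiningKFiniteSwap` §3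
(a bounded continuous weight `w(r)` is threaded through the domination); credit to those files for the skeleton.
-/
import Summits.HodgeConjecture.HodgeConjecture.Theorems.K2LiuArchIntertwiningKFiniteSwap   -- ★ FILE 1 engine + ★ FILE 2 majorants + ★ the K-finite swap (untwisted)
import HarnessLib

/-!
# Crux `HLiu418`, (Φ-S1) road B, files (iii-b-1)+(iii-b-2): the TWISTED big-cell functional `F ↦ ∫ w(X) F(J n(X) g) dX` commutes with `d/dt` along
# `U(J)`-valued curves — for every majorised pair `(F, D)` (§1) and for every `K_w`-finite Siegel section along `exp(tX)`, `X ∈ 𝔲(J)` (§2)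

Cell `hodgecm-mathlib`, crux item hLiu418 = `stmt-HodgeConjecture-24832` (helper lane, count-neutral).  Road B of (Φ-S1): the twisted archimedean
block of a non-scalar `K_w`-type vector is reached from the scalar block (★ p863260 ∕ ★ p863574, explicit in the point) by RAY DERIVATIVES in the
point, because the `K_w`-types are produced by the Lie-algebra arrows (★ `rung_pair`, `D_X F = y ↦ d/dt|₀ F(y·exp(tX))`).  The analytic half of
that ladder is the swap `∫ w(X_r) (D_X F)(J n(X_r) g) dr = d/dt|₀ ∫ w(X_r) F(J n(X_r) g·exp(tX)) dr` for a bounded continuous weight `w`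
(instance: the character `w(r) = e(−τ(T·hermOfReal r))`, `‖w‖ = 1`).  The untwisted case `w = 1` is ★ FILE 1 ∕ ★ `KFiniteSwap` §3; the weight is
independent of `t` and of the point and bounded by `1`, so it passes through the domination verbatim.
* §1 **`integrable_and_hasDerivAt_twisted_of_dominated`** (twin of ★ `integrable_and_hasDerivAt_archIntertwining_of_dominated`: binders `hσ hg hγ0 hγc hγU F D
  hFc hDc hCD hFb hDb hFD` + `(w) (hwc : Continuous w) (hw : ∀ r, ‖w r‖ ≤ 1)`);
* §2 **`integrable_and_hasDerivAt_twisted_rayDeriv`** (twin of ★ `integrable_and_hasDerivAt_archIntertwining_rayDeriv`: every `K_w`-finite `F ∈ I_w(s,χ_k)`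
  with a compact picture `Q`, every `X = C·(αβγδ)·C′ ∈ 𝔲(J)`, every `g ∈ U(J)`, `re s > ½`).

HONEST LABEL: analytic swap only; the assembly (iii-b-3) along ★ `ladder_pair_from`'s word is the next file; closes no socket.  HC_CM is proved only
modulo the 7 printed citations (2 remaining named inputs: hLiu418 = `stmt-HodgeConjecture-24832`, h413 = `stmt-HodgeConjecture-24833`) until rung 0 closes.

## References
* [Knapp1986] A. W. Knapp, *Representation Theory of Semisimple Groups*, Princeton (1986), Ch. VII §§3–4, Ch. VIII §3.
* [Shimura1997] G. Shimura, *Euler Products and Eisenstein Series*, CBMS 93 (1997), §16.4.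
* [LeeZhu1998] S. T. Lee, C.-B. Zhu, *Degenerate principal series and local theta correspondence II*, Israel J. Math. 100 (1997/98), §5.
-/

set_option autoImplicit false
set_option linter.dupNamespace false

noncomputable section

open Complex Matrix MeasureTheory Filter NormedSpace
open scoped ComplexConjugate ComplexOrder Topology

namespace Summit.HodgeConjecture.HodgeConjecture.Cruxes.HLiu418.K2LiuArchTwistedIntertwiningKFiniteSwap

open Literature.NumberTheory.ModularForms.SiegelUpperHalfSpace (num denom moeb num_def denom_def moeb_def moeb_mul_denom)
open Summit.HodgeConjecture.HodgeConjecture.Cruxes.HLiu418.K2LiuHermTwoGammaDefs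
open Summit.HodgeConjecture.HodgeConjecture.Cruxes.HLiu418.K2LiuHermitianTubeCocycle (mul_mem_UJ J_mem isUnit_det_denom posDef_im_moeb
  posDef_im_I_smul_one isHermitian_re re_add_I_smul_im)
open Summit.HodgeConjecture.HodgeConjecture.Cruxes.HLiu418.K2LiuArchInducedTubeDefs
open Summit.HodgeConjecture.HodgeConjecture.Cruxes.HLiu418.K2LiuArchIntertwiningMajorant
open Summit.HodgeConjecture.HodgeConjecture.Cruxes.HLiu418.K2LiuHermTwoResolventBounds
open Summit.HodgeConjecture.HodgeConjecture.Cruxes.HLiu418.K2LiuArchIntertwiningLieDerivativePrelims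
open Summit.HodgeConjecture.HodgeConjecture.Cruxes.HLiu418.K2LiuU22ShilovCoordinate
open Summit.HodgeConjecture.HodgeConjecture.Cruxes.HLiu418.K2LiuU22CompactPictureDefs
open Summit.HodgeConjecture.HodgeConjecture.Cruxes.HLiu418.K2LiuU22CompactPictureOperatorDictionary
open Summit.HodgeConjecture.HodgeConjecture.Cruxes.HLiu418.K2LiuLieRayDifferentiability (conjTranspose_exp_mul_J_mul_exp exp_add_smul)
open Summit.HodgeConjecture.HodgeConjecture.Cruxes.HLiu418.K2LiuArchScalarSectionCurveDerivative (exp_zero_smul_eq_one)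
open Summit.HodgeConjecture.HodgeConjecture.Cruxes.HLiu418.K2LiuArchIntertwiningLieDerivative (continuous_of_entry_hasDerivAt)
open Summit.HodgeConjecture.HodgeConjecture.Cruxes.HLiu418.K2LiuArchIntertwiningLieDerivativeExp (hasDerivAt_exp_smul_entry_at)
open Summit.HodgeConjecture.HodgeConjecture.Cruxes.HLiu418.K2LiuArchIntertwiningDominatedSwap
open Summit.HodgeConjecture.HodgeConjecture.Cruxes.HLiu418.K2LiuArchKFiniteSectionMajorised
open Summit.HodgeConjecture.HodgeConjecture.Cruxes.HLiu418.K2LiuArchIntertwiningKFiniteSwap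

/-! ## §1 The twisted dominated swap lemma -/

/-- **THE TWISTED DOMINATED SWAP LEMMA**: for a bounded continuous weight `w` (`‖w r‖ ≤ 1`) and the data of ★ FILE 1 (`σ > ½`, `g ∈ U(J)`, a continuous
`U(J)`-valued curve `γ` with `γ 0 = 1`, a pair `(F, D)` continuous on `U(J)`, majorised by `‖j(·,i1)‖^{−(2σ+2)}`, with `d/dt F(yγ_t) = D(yγ_t)`),
`r ↦ w(r)·D(J n(X_r) g)` is integrable and `t ↦ ∫ w(r)·F(J n(X_r)·gγ_t) dr` has derivative `∫ w(r)·D(J n(X_r) g) dr` at `0`.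
[Knapp1986, Ch. VII §3] [Shimura1997, §16.4] -/
theorem integrable_and_hasDerivAt_twisted_of_dominated {σ : ℝ} (hσ : 1 / 2 < σ)
    {g : Matrix (Fin 2 ⊕ Fin 2) (Fin 2 ⊕ Fin 2) ℂ} (hg : gᴴ * Matrix.J (Fin 2) ℂ * g = Matrix.J (Fin 2) ℂ)
    {γ : ℝ → Matrix (Fin 2 ⊕ Fin 2) (Fin 2 ⊕ Fin 2) ℂ} (hγ0 : γ 0 = 1) (hγc : Continuous γ)
    (hγU : ∀ t, (γ t)ᴴ * Matrix.J (Fin 2) ℂ * γ t = Matrix.J (Fin 2) ℂ)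
    (F D : Matrix (Fin 2 ⊕ Fin 2) (Fin 2 ⊕ Fin 2) ℂ → ℂ)
    (hFc : ContinuousOn F {y | yᴴ * Matrix.J (Fin 2) ℂ * y = Matrix.J (Fin 2) ℂ})
    (hDc : ContinuousOn D {y | yᴴ * Matrix.J (Fin 2) ℂ * y = Matrix.J (Fin 2) ℂ})
    {CF CD : ℝ} (hCD : 0 ≤ CD)
    (hFb : ∀ y : Matrix (Fin 2 ⊕ Fin 2) (Fin 2 ⊕ Fin 2) ℂ, yᴴ * Matrix.J (Fin 2) ℂ * y = Matrix.J (Fin 2) ℂ →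
      ‖F y‖ ≤ CF * ‖(denom y (I • (1 : Matrix (Fin 2) (Fin 2) ℂ))).det‖ ^ (-(2 * σ + 2)))
    (hDb : ∀ y : Matrix (Fin 2 ⊕ Fin 2) (Fin 2 ⊕ Fin 2) ℂ, yᴴ * Matrix.J (Fin 2) ℂ * y = Matrix.J (Fin 2) ℂ →
      ‖D y‖ ≤ CD * ‖(denom y (I • (1 : Matrix (Fin 2) (Fin 2) ℂ))).det‖ ^ (-(2 * σ + 2)))
    (hFD : ∀ y : Matrix (Fin 2 ⊕ Fin 2) (Fin 2 ⊕ Fin 2) ℂ, yᴴ * Matrix.J (Fin 2) ℂ * y = Matrix.J (Fin 2) ℂ →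
      ∀ t : ℝ, HasDerivAt (fun t : ℝ => F (y * γ t)) (D (y * γ t)) t)
    (w : (Fin 2 → Fin 2 → ℝ) → ℂ) (hwc : Continuous w) (hw : ∀ r, ‖w r‖ ≤ 1) :
    Integrable (fun r : Fin 2 → Fin 2 → ℝ => w r * D (Matrix.J (Fin 2) ℂ * fromBlocks 1 (hermOfReal r) 0 1 * g)) ∧
      HasDerivAt (fun t : ℝ => ∫ r : Fin 2 → Fin 2 → ℝ, w r * F (Matrix.J (Fin 2) ℂ * fromBlocks 1 (hermOfReal r) 0 1 * (g * γ t)))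
        (∫ r : Fin 2 → Fin 2 → ℝ, w r * D (Matrix.J (Fin 2) ℂ * fromBlocks 1 (hermOfReal r) 0 1 * g)) 0 := by
  have ha : 0 ≤ 2 * σ + 2 := by linarith
  have ha3 : 3 < 2 * σ + 2 := by linarith
  -- (1) the curve data
  have hgγ : ∀ t, (g * γ t)ᴴ * Matrix.J (Fin 2) ℂ * (g * γ t) = Matrix.J (Fin 2) ℂ := fun t => mul_mem_UJ hg (hγU t)
  have hh : Continuous fun t => g * γ t := continuous_const.mul hγc
  obtain ⟨d, hd⟩ : ∃ d : ℝ → Matrix (Fin 2) (Fin 2) ℂ, d = fun t => denom (g * γ t) (I • (1 : Matrix (Fin 2) (Fin 2) ℂ)) := ⟨_, rfl⟩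
  obtain ⟨Z, hZ⟩ : ∃ Z : ℝ → Matrix (Fin 2) (Fin 2) ℂ, Z = fun t => moeb (g * γ t) (I • (1 : Matrix (Fin 2) (Fin 2) ℂ)) := ⟨_, rfl⟩
  have hdu : ∀ t, IsUnit (d t).det := fun t => by rw [hd]; exact isUnit_det_denom (hgγ t) posDef_im_I_smul_one
  have hd_cont : Continuous d := by rw [hd]; exact (continuous_denom _).comp hh
  have hd0 : (d 0).det ≠ 0 := (hdu 0).ne_zero
  have hdet_cont : ContinuousAt (fun t => (d t).det) 0 := hd_cont.matrix_det.continuousAt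
  have hdinv_cont : ContinuousAt (fun t => (d t)⁻¹) 0 := by
    have hA := continuousAt_matrix_inv (d 0) (by rw [Ring.inverse_eq_inv']; exact continuousAt_inv₀ hd0)
    exact ContinuousAt.comp (g := Inv.inv) hA hd_cont.continuousAt
  have hZ_cont : ContinuousAt Z 0 := by
    have hn : Continuous fun t => num (g * γ t) (I • (1 : Matrix (Fin 2) (Fin 2) ℂ)) := (continuous_num _).comp hh
    have h := hn.continuousAt.mul hdinv_cont
    rw [hZ]
    simp only [moeb_def, hd] at h ⊢
    exact h
  -- (2) the tube point `Z 0 = U₀ + iV₀` and the resolvent constants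
  set U₀ : Matrix (Fin 2) (Fin 2) ℂ := (2 : ℂ)⁻¹ • (Z 0 + (Z 0)ᴴ) with hU₀
  set V₀ : Matrix (Fin 2) (Fin 2) ℂ := (2 * I)⁻¹ • (Z 0 - (Z 0)ᴴ) with hV₀
  have hU₀h : U₀.IsHermitian := isHermitian_re (Z 0)
  have hV₀p : V₀.PosDef := by
    have h : ((2 * I)⁻¹ • (moeb (g * γ 0) (I • (1 : Matrix (Fin 2) (Fin 2) ℂ)) - (moeb (g * γ 0) (I • (1 : Matrix (Fin 2) (Fin 2) ℂ)))ᴴ)).PosDef :=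
      posDef_im_moeb (hgγ 0) posDef_im_I_smul_one
    rw [hV₀, hZ]
    exact h
  have hZ₀ : U₀ + I • V₀ = Z 0 := re_add_I_smul_im (Z 0)
  obtain ⟨c₀, C₁, hc₀, -, hres₀⟩ := exists_resolvent_bound hU₀h hV₀p
  obtain ⟨η, C, hη, -, hres⟩ := exists_resolvent_perturb hU₀h hV₀p
  -- (3) the good set
  set δ₀ : ℝ := ‖(d 0).det‖ / 2 with hδ₀
  have hδ₀pos : 0 < δ₀ := by have := norm_pos_iff.mpr hd0; positivity
  have hgood : ∀ᶠ t in 𝓝 (0 : ℝ), (∀ i j, ‖(Z t - Z 0) i j‖ ≤ η) ∧ δ₀ ≤ ‖(d t).det‖ := by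
    filter_upwards [eventually_norm_sub_apply_le hZ_cont hη, eventually_half_norm_le hdet_cont hd0] with t h1 h2
    exact ⟨h1, h2⟩
  have hkey : ∀ t : ℝ, ((∀ i j, ‖(Z t - Z 0) i j‖ ≤ η) ∧ δ₀ ≤ ‖(d t).det‖) → ∀ X : Matrix (Fin 2) (Fin 2) ℂ, X.IsHermitian →
      ‖(X + Z 0).det‖ ≤ 4 * ‖(X + Z t).det‖ ∧ 0 < ‖(X + Z 0).det‖ := by
    intro t ht X hX
    have hE := hres X (Z t - Z 0) hX ht.1
    have hsum : X + (U₀ + I • V₀) + (Z t - Z 0) = X + Z t := by rw [hZ₀]; abel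
    rw [hsum, hZ₀] at hE
    have h0 : 0 < ‖(X + Z 0).det‖ := by
      have h := (hres₀ X hX).1
      rw [hZ₀] at h
      exact hc₀.trans_le h
    exact ⟨hE.1, h0⟩
  -- (4) the integrands and the majorant
  obtain ⟨Φ, hΦ⟩ : ∃ Φ : ℝ → (Fin 2 → Fin 2 → ℝ) → ℂ,
      Φ = fun t r => w r * F (Matrix.J (Fin 2) ℂ * fromBlocks 1 (hermOfReal r) 0 1 * (g * γ t)) := ⟨_, rfl⟩
  obtain ⟨Φ', hΦ'⟩ : ∃ Φ' : ℝ → (Fin 2 → Fin 2 → ℝ) → ℂ,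
      Φ' = fun t r => w r * D (Matrix.J (Fin 2) ℂ * fromBlocks 1 (hermOfReal r) 0 1 * (g * γ t)) := ⟨_, rfl⟩
  have hwle : ∀ (r : Fin 2 → Fin 2 → ℝ) (z : ℂ), ‖w r * z‖ ≤ ‖z‖ := fun r z => by
    rw [norm_mul]
    exact mul_le_of_le_one_left (norm_nonneg _) (hw r)
  obtain ⟨bound, hbound⟩ : ∃ bound : (Fin 2 → Fin 2 → ℝ) → ℝ, bound = fun r =>
      CD * ((4 : ℝ) ^ (2 * σ + 2) * δ₀ ^ (-(2 * σ + 2)) * ‖(hermOfReal r + Z 0).det‖ ^ (-(2 * σ + 2))) := ⟨_, rfl⟩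
  have hmaj : Integrable (fun r : Fin 2 → Fin 2 → ℝ => ‖(hermOfReal r + Z 0).det‖ ^ (-(2 * σ + 2))) := by
    have h := integrable_norm_det_hermOfReal_add_rpow_neg hU₀h hV₀p ha3
    rw [hZ₀] at h
    exact h
  have hbound_int : Integrable bound := by
    rw [hbound]
    exact (hmaj.const_mul _).const_mul _
  -- the factorisation `j(J n(X) g γ_t, i1) = (X + Z_t)·d_t` and the pointwise estimate on the good set
  have hΔ : ∀ (t : ℝ) (X : Matrix (Fin 2) (Fin 2) ℂ),
      denom (Matrix.J (Fin 2) ℂ * fromBlocks 1 X 0 1 * (g * γ t)) (I • (1 : Matrix (Fin 2) (Fin 2) ℂ)) = (X + Z t) * d t := by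
    intro t X
    have h := denom_transl_eq_mul X (h := g * γ t) (by have := hdu t; rw [hd] at this; exact this)
    rw [hZ, hd]
    exact h
  have hjest : ∀ t : ℝ, ((∀ i j, ‖(Z t - Z 0) i j‖ ≤ η) ∧ δ₀ ≤ ‖(d t).det‖) → ∀ r : Fin 2 → Fin 2 → ℝ,
      ‖(denom (Matrix.J (Fin 2) ℂ * fromBlocks 1 (hermOfReal r) 0 1 * (g * γ t)) (I • (1 : Matrix (Fin 2) (Fin 2) ℂ))).det‖ ^ (-(2 * σ + 2)) ≤
        (4 : ℝ) ^ (2 * σ + 2) * δ₀ ^ (-(2 * σ + 2)) * ‖(hermOfReal r + Z 0).det‖ ^ (-(2 * σ + 2)) := by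
    intro t ht r
    obtain ⟨h4, h0⟩ := hkey t ht _ (isHermitian_hermOfReal r)
    rw [hΔ, det_mul, norm_mul, Real.mul_rpow (norm_nonneg _) (norm_nonneg _)]
    have h1 : ‖(hermOfReal r + Z t).det‖ ^ (-(2 * σ + 2)) ≤ (4 : ℝ) ^ (2 * σ + 2) * ‖(hermOfReal r + Z 0).det‖ ^ (-(2 * σ + 2)) :=
      rpow_neg_le_of_le_four_mul h0 h4 ha
    have h2 : ‖(d t).det‖ ^ (-(2 * σ + 2)) ≤ δ₀ ^ (-(2 * σ + 2)) := Real.rpow_le_rpow_of_nonpos hδ₀pos ht.2 (by linarith)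
    calc ‖(hermOfReal r + Z t).det‖ ^ (-(2 * σ + 2)) * ‖(d t).det‖ ^ (-(2 * σ + 2))
        ≤ ((4 : ℝ) ^ (2 * σ + 2) * ‖(hermOfReal r + Z 0).det‖ ^ (-(2 * σ + 2))) * δ₀ ^ (-(2 * σ + 2)) :=
          mul_le_mul h1 h2 (Real.rpow_nonneg (norm_nonneg _) _) (by positivity)
      _ = (4 : ℝ) ^ (2 * σ + 2) * δ₀ ^ (-(2 * σ + 2)) * ‖(hermOfReal r + Z 0).det‖ ^ (-(2 * σ + 2)) := by ring
  -- (5) the six hypotheses of dominated differentiation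
  have hmemr : ∀ (t : ℝ) (r : Fin 2 → Fin 2 → ℝ),
      (Matrix.J (Fin 2) ℂ * fromBlocks 1 (hermOfReal r) 0 1 * (g * γ t))ᴴ * Matrix.J (Fin 2) ℂ *
        (Matrix.J (Fin 2) ℂ * fromBlocks 1 (hermOfReal r) 0 1 * (g * γ t)) = Matrix.J (Fin 2) ℂ :=
    fun t r => mul_mem_UJ (J_mul_transl_hermOfReal_mem r) (hgγ t)
  have hF_meas : ∀ᶠ t in 𝓝 (0 : ℝ), AEStronglyMeasurable (Φ t) volume := by
    refine Eventually.of_forall fun t => ?_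
    rw [hΦ]
    exact (hwc.mul (hFc.comp_continuous (continuous_transl_mul (g * γ t)) fun r => hmemr t r)).aestronglyMeasurable
  have hF'_meas : AEStronglyMeasurable (Φ' 0) volume := by
    rw [hΦ']
    exact (hwc.mul (hDc.comp_continuous (continuous_transl_mul (g * γ 0)) fun r => hmemr 0 r)).aestronglyMeasurable
  have hgood0 := hgood.self_of_nhds
  have hF_int : Integrable (Φ 0) volume := by
    rw [hΦ]
    have h0 := integrable_of_dominated hσ (hgγ 0) F hFc hFb
    exact h0.norm.mono' (hwc.mul (hFc.comp_continuous (continuous_transl_mul (g * γ 0)) fun r => hmemr 0 r)).aestronglyMeasurable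
      (Eventually.of_forall fun r => hwle r _)
  have h_bound : ∀ᵐ r ∂(volume : Measure (Fin 2 → Fin 2 → ℝ)), ∀ t ∈ {t : ℝ | (∀ i j, ‖(Z t - Z 0) i j‖ ≤ η) ∧ δ₀ ≤ ‖(d t).det‖},
      ‖Φ' t r‖ ≤ bound r := by
    refine Eventually.of_forall fun r t ht => ?_
    rw [hΦ', hbound]
    exact (hwle r _).trans ((hDb _ (hmemr t r)).trans (mul_le_mul_of_nonneg_left (hjest t ht r) hCD))
  have h_diff : ∀ᵐ r ∂(volume : Measure (Fin 2 → Fin 2 → ℝ)), ∀ t ∈ {t : ℝ | (∀ i j, ‖(Z t - Z 0) i j‖ ≤ η) ∧ δ₀ ≤ ‖(d t).det‖},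
      HasDerivAt (fun t => Φ t r) (Φ' t r) t := by
    refine Eventually.of_forall fun r t _ => ?_
    have h := (hFD (Matrix.J (Fin 2) ℂ * fromBlocks 1 (hermOfReal r) 0 1 * g) (mul_mem_UJ (J_mul_transl_hermOfReal_mem r) hg) t).const_mul (w r)
    rw [hΦ, hΦ']
    simp only [Matrix.mul_assoc] at h ⊢
    exact h
  -- (6) dominated differentiation
  have hmain := hasDerivAt_integral_of_dominated_loc_of_deriv_le hgood hF_meas hF_int hF'_meas h_bound hbound_int h_diff
  refine ⟨?_, ?_⟩
  · have h1 := hmain.1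
    rw [hΦ'] at h1
    simpa only [hγ0, Matrix.mul_one] using h1
  · have h2 := hmain.2
    rw [hΦ, hΦ'] at h2
    simp only [hγ0, Matrix.mul_one] at h2
    exact h2


/-! ## §2 The twisted swap for every `K_w`-finite Siegel section along `exp(tX)` -/

/-- **THE TWISTED SWAP LEMMA FOR EVERY `K_w`-FINITE SIEGEL SECTION** (`re s > ½`, `g ∈ U(J)`, `X = C·(α β; γ δ)·C′ ∈ 𝔲(J)`, bounded continuous weight `w`):
`HasDerivAt (t ↦ ∫ w(r) F(J n(X_r) g·exp(tX)) dr) (∫ w(r) (D_X F)(J n(X_r) g) dr) 0`, the derivative integrand being integrable — §1 with the binders of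
★ FILE 2 for `F` and `D_X F` (★ `KFiniteSwap` §1–§2).  [Knapp1986, Ch. VII §§3–4] [Shimura1997, §16.4] [LeeZhu1998, §5] -/
theorem integrable_and_hasDerivAt_twisted_rayDeriv (k : ℤ) {s : ℂ} (hs : 1 / 2 < s.re) {F : Matrix (Fin 2 ⊕ Fin 2) (Fin 2 ⊕ Fin 2) ℂ → ℂ}
    (hF : IsArchSiegelSection (fun z : ℂ => (conj z / ((‖z‖ : ℝ) : ℂ)) ^ k) s F) (Q : Carrier)
    (hFQ : ∀ (v : Matrix (Fin 2) (Fin 2) ℂ), vᴴ * v = 1 → ∀ hv : v.det ≠ 0,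
      F ((2 : ℂ)⁻¹ • fromBlocks (1 + v) (-(I • (1 - v))) (I • (1 - v)) (1 + v)) = evalAt v hv Q)
    (α β γ δ : Matrix (Fin 2) (Fin 2) ℂ)
    (hX : (fromBlocks 1 1 (I • 1) (-(I • 1)) * fromBlocks α β γ δ * ((2 : ℂ)⁻¹ • fromBlocks 1 (-(I • 1)) 1 (I • 1)) : Matrix (Fin 2 ⊕ Fin 2) (Fin 2 ⊕ Fin 2) ℂ)ᴴ *
        Matrix.J (Fin 2) ℂ + Matrix.J (Fin 2) ℂ * (fromBlocks 1 1 (I • 1) (-(I • 1)) * fromBlocks α β γ δ * ((2 : ℂ)⁻¹ • fromBlocks 1 (-(I • 1)) 1 (I • 1))) = 0)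
    {g : Matrix (Fin 2 ⊕ Fin 2) (Fin 2 ⊕ Fin 2) ℂ} (hg : gᴴ * Matrix.J (Fin 2) ℂ * g = Matrix.J (Fin 2) ℂ)
    (w : (Fin 2 → Fin 2 → ℝ) → ℂ) (hwc : Continuous w) (hw : ∀ r, ‖w r‖ ≤ 1) :
    Integrable (fun r : Fin 2 → Fin 2 → ℝ => w r * (fun y : Matrix (Fin 2 ⊕ Fin 2) (Fin 2 ⊕ Fin 2) ℂ => deriv (fun t : ℝ => F (y *
        exp (t • (fromBlocks 1 1 (I • 1) (-(I • 1)) * fromBlocks α β γ δ * ((2 : ℂ)⁻¹ • fromBlocks 1 (-(I • 1)) 1 (I • 1)) : Matrix (Fin 2 ⊕ Fin 2) (Fin 2 ⊕ Fin 2) ℂ)))) 0)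
        (Matrix.J (Fin 2) ℂ * fromBlocks 1 (hermOfReal r) 0 1 * g)) ∧
      HasDerivAt (fun t : ℝ => ∫ r : Fin 2 → Fin 2 → ℝ, w r * F (Matrix.J (Fin 2) ℂ * fromBlocks 1 (hermOfReal r) 0 1 * (g *
          exp (t • (fromBlocks 1 1 (I • 1) (-(I • 1)) * fromBlocks α β γ δ * ((2 : ℂ)⁻¹ • fromBlocks 1 (-(I • 1)) 1 (I • 1)) : Matrix (Fin 2 ⊕ Fin 2) (Fin 2 ⊕ Fin 2) ℂ)))))
        (∫ r : Fin 2 → Fin 2 → ℝ, w r * (fun y : Matrix (Fin 2 ⊕ Fin 2) (Fin 2 ⊕ Fin 2) ℂ => deriv (fun t : ℝ => F (y *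
          exp (t • (fromBlocks 1 1 (I • 1) (-(I • 1)) * fromBlocks α β γ δ * ((2 : ℂ)⁻¹ • fromBlocks 1 (-(I • 1)) 1 (I • 1)) : Matrix (Fin 2 ⊕ Fin 2) (Fin 2 ⊕ Fin 2) ℂ)))) 0)
          (Matrix.J (Fin 2) ℂ * fromBlocks 1 (hermOfReal r) 0 1 * g)) 0 := by
  set X : Matrix (Fin 2 ⊕ Fin 2) (Fin 2 ⊕ Fin 2) ℂ := fromBlocks 1 1 (I • 1) (-(I • 1)) * fromBlocks α β γ δ * ((2 : ℂ)⁻¹ • fromBlocks 1 (-(I • 1)) 1 (I • 1)) with hXdef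
  have hD : IsArchSiegelSection (fun z : ℂ => (conj z / ((‖z‖ : ℝ) : ℂ)) ^ k) s (fun y => deriv (fun t : ℝ => F (y * exp (t • X))) 0) :=
    isArchSiegelSection_rayDeriv hF X
  have hDQ : ∀ (u : Matrix (Fin 2) (Fin 2) ℂ), uᴴ * u = 1 → ∀ hu : u.det ≠ 0,
      (fun y => deriv (fun t : ℝ => F (y * exp (t • X))) 0) ((2 : ℂ)⁻¹ • fromBlocks (1 + u) (-(I • (1 - u))) (I • (1 - u)) (1 + u)) = evalAt u hu _ :=
    fun u hu hu' => rayDeriv_kU_eq_evalAt_op k s hF Q hFQ α β γ δ hX u hu hu'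
  obtain ⟨CF, -, hFb⟩ := exists_norm_apply_le k s hF Q hFQ
  obtain ⟨CD, hCD, hDb⟩ := exists_norm_apply_le k s hD _ hDQ
  have hFc := continuousOn_UJ k s hF Q hFQ
  have hDc := continuousOn_UJ k s hD _ hDQ
  have hdiff := differentiableAt_ray_kU k s hF Q hFQ α β γ δ hX
  have hFD : ∀ y : Matrix (Fin 2 ⊕ Fin 2) (Fin 2 ⊕ Fin 2) ℂ, yᴴ * Matrix.J (Fin 2) ℂ * y = Matrix.J (Fin 2) ℂ →
      ∀ t : ℝ, HasDerivAt (fun t : ℝ => F (y * exp (t • X))) ((fun y => deriv (fun t : ℝ => F (y * exp (t • X))) 0) (y * exp (t • X))) t :=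
    fun y hy t₀ => hasDerivAt_ray hF hX hdiff hy t₀
  exact integrable_and_hasDerivAt_twisted_of_dominated hs hg (exp_zero_smul_eq_one X)
    (continuous_of_entry_hasDerivAt (γ' := fun t => X * exp (t • X)) (hasDerivAt_exp_smul_entry_at X)) (conjTranspose_exp_mul_J_mul_exp hX)
    F _ hFc hDc hCD hFb hDb hFD w hwc hw

end Summit.HodgeConjecture.HodgeConjecture.Cruxes.HLiu418.K2LiuArchTwistedIntertwiningKFiniteSwap

end
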